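import Mathlib
import Literature.NumberTheory.Transcendental.KZRulesAssociator

/-!
# `TateLifting` (stmt-KontsevichZagierPeriods-9129), line `Sketch` — stub `stub_algIndepSaturation`

ALGEBRAIC-INDEPENDENCE SATURATION in the formal period ring
`P = KZ.FormalPeriodRing = FormalRep ⧸ relations` of the Kontsevich–Zagier calculus (a commutative
ring with the evaluation `KZ.evalP : P →+* ℝ`, `Literature/…/KZRulesAssociator.lean`). Pure algebra:
if `evalP` is injective on a subring `R₀ ≤ P` all of whose values `evalP a` are algebraic over `ℚ`,
and the values `evalP (x i)` of a family of classes `x : ι → P` are algebraically independent over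
`ℚ`, then `evalP` is injective on the subring generated by `R₀` and the `x i`.

Proof. An element of `Subring.closure (R₀ ∪ range x)` is `p(x)` for a polynomial
`p ∈ MvPolynomial ι R₀` (`AlgIndepSaturation.exists_eval₂Hom_eq`). Its value is the polynomial
`ψ p ∈ MvPolynomial ι K`, `K = algebraicClosure ℚ ℝ` the relative algebraic closure of `ℚ` in `ℝ`,
`ψ = evalP|R₀ : R₀ →+* K` (well defined because the values of `R₀` are algebraic), evaluated at the
point `(evalP (x i))ᵢ`; algebraic independence over `ℚ` persists over `K`
(`AlgebraicIndependent.algebraicClosure`, Mathlib), so `evalP (p(x)) = 0` forces `ψ p = 0`, and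
`ψ` is injective because `evalP` is injective on `R₀` (`MvPolynomial.map_injective`), so `p = 0`.

This is the transfer lemma of the transcendence sector of the line: together with the ring of
dimension-zero classes (`stub_dimZeroRing`) it turns every algebraic-independence theorem about
period VALUES into the kernel form of Conjecture 1 on the `K₀`-algebra generated by the corresponding
classes (composition `transcKernel_of` in the lead's skeleton `Cruxes/TateLifting/Lines/Sketch.lean`).

References: M. Kontsevich, D. Zagier, *Periods* (2001), §1.2 (Conjecture 1), §4.1 (the ring of
periods). The algebra is folklore.
-/

noncomputable section

open Literature.NumberTheory.Transcendental

namespace Summit.KontsevichZagierPeriods.InverseLandau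

namespace AlgIndepSaturation

/-- **Elements of `Subring.closure (R₀ ∪ range x)` are polynomial expressions** `p(x)`,
`p ∈ MvPolynomial ι R₀`, in a commutative ring (closure induction; `C a` for `a ∈ R₀`, `X i` for
`x i`). [folklore] -/
theorem exists_eval₂Hom_eq {P : Type*} [CommRing P] {ι : Type*} (x : ι → P) (R₀ : Subring P)
    {y : P} (hy : y ∈ Subring.closure ((R₀ : Set P) ∪ Set.range x)) :
    ∃ p : MvPolynomial ι R₀, MvPolynomial.eval₂Hom R₀.subtype x p = y := by
  induction hy using Subring.closure_induction with
  | mem z hz =>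
    rcases hz with hz | ⟨i, rfl⟩
    · exact ⟨MvPolynomial.C ⟨z, hz⟩, by simp⟩
    · exact ⟨MvPolynomial.X i, by simp⟩
  | zero => exact ⟨0, by simp⟩
  | one => exact ⟨1, by simp⟩
  | add a b _ _ ha hb =>
    obtain ⟨p, rfl⟩ := ha
    obtain ⟨q, rfl⟩ := hb
    exact ⟨p + q, by simp⟩
  | neg a _ ha =>
    obtain ⟨p, rfl⟩ := ha
    exact ⟨-p, by simp⟩
  | mul a b _ _ ha hb =>
    obtain ⟨p, rfl⟩ := ha
    obtain ⟨q, rfl⟩ := hb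
    exact ⟨p * q, by simp⟩

/-- **Injectivity of an evaluation on `R₀[x]` from algebraic independence of the values**
(abstract form, any commutative ring `P` with a ring map `φ : P →+* ℝ`): if `φ` is injective on the
subring `R₀` with `φ(R₀)` algebraic over `ℚ`, and `φ ∘ x` is algebraically independent over `ℚ`,
then `φ` is injective on `Subring.closure (R₀ ∪ range x)`. [folklore] -/
theorem eq_zero_of_eval_eq_zero {P : Type*} [CommRing P] (φ : P →+* ℝ) {ι : Type*} (x : ι → P)
    (R₀ : Subring P) (halg : ∀ a ∈ R₀, IsAlgebraic ℚ (φ a)) (hinj : ∀ a ∈ R₀, φ a = 0 → a = 0)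
    (hx : AlgebraicIndependent ℚ fun i => φ (x i)) {y : P}
    (hy : y ∈ Subring.closure ((R₀ : Set P) ∪ Set.range x)) (hy0 : φ y = 0) : y = 0 := by
  obtain ⟨p, rfl⟩ := exists_eval₂Hom_eq x R₀ hy
  -- algebraic independence persists over the relative algebraic closure `K` of `ℚ` in `ℝ`
  have hK : AlgebraicIndependent (algebraicClosure ℚ ℝ) fun i => φ (x i) := hx.algebraicClosure
  -- the coefficient map `ψ = φ|R₀ : R₀ →+* K`
  have hmem : ∀ a : R₀, (φ.comp R₀.subtype) a ∈ algebraicClosure ℚ ℝ := fun a =>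
    mem_algebraicClosure_iff.2 (halg a a.2)
  set ψ : R₀ →+* algebraicClosure ℚ ℝ := (φ.comp R₀.subtype).codRestrict (algebraicClosure ℚ ℝ) hmem
    with hψ_def
  have hψ : Function.Injective ψ := by
    refine (injective_iff_map_eq_zero ψ).2 fun a ha => ?_
    have ha' : φ (a : P) = 0 := by
      have := congrArg (fun z : algebraicClosure ℚ ℝ => (z : ℝ)) ha
      simpa [hψ_def] using this
    exact Subtype.ext (hinj _ a.2 ha')
  -- the value of `p(x)` is `(ψ p)(φ ∘ x)`
  have key : MvPolynomial.aeval (fun i => φ (x i)) (MvPolynomial.map ψ p) =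
      φ (MvPolynomial.eval₂Hom R₀.subtype x p) := by
    rw [MvPolynomial.aeval_def, MvPolynomial.eval₂_map, MvPolynomial.coe_eval₂Hom,
      MvPolynomial.eval₂_comp_left]
    rfl
  have hzero : MvPolynomial.map ψ p = 0 := by
    refine hK.eq_zero_of_aeval_eq_zero _ ?_
    rw [key, hy0]
  have hp : p = 0 :=
    MvPolynomial.map_injective (ψ : R₀ →+* algebraicClosure ℚ ℝ) hψ (by rw [hzero, map_zero])
  rw [hp, map_zero]

end AlgIndepSaturation

/-- **Algebraic-independence saturation** (stub `stub_algIndepSaturation` of the lead's skeleton, the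
body of `AlgIndepSaturation`): in the formal period ring `P = KZ.FormalPeriodRing`, if `KZ.evalP` is
injective on a subring `R₀` whose values are algebraic over `ℚ`, and the values `evalP (x i)` of a
family of classes are algebraically independent over `ℚ`, then `evalP` is injective on the subring
generated by `R₀` and the `x i` (every element is `p(x)` with `p ∈ MvPolynomial ι R₀`; its value is
the `evalP`-image polynomial over `K = algebraicClosure ℚ ℝ` at an algebraically independent point,
`AlgebraicIndependent.algebraicClosure`; `MvPolynomial.map_injective`). [folklore] -/
theorem tateLifting_algIndepSaturation :
    ∀ (ι : Type) (x : ι → KZ.FormalPeriodRing) (R₀ : Subring KZ.FormalPeriodRing),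
      (∀ a ∈ R₀, IsAlgebraic ℚ (KZ.evalP a)) → (∀ a ∈ R₀, KZ.evalP a = 0 → a = 0) →
      AlgebraicIndependent ℚ (fun i => KZ.evalP (x i)) →
      ∀ y ∈ Subring.closure ((R₀ : Set KZ.FormalPeriodRing) ∪ Set.range x),
        KZ.evalP y = 0 → y = 0 :=
  fun _ x R₀ halg hinj hx _ hy hy0 =>
    AlgIndepSaturation.eq_zero_of_eval_eq_zero KZ.evalP x R₀ halg hinj hx hy hy0

end Summit.KontsevichZagierPeriods.InverseLandau

end
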